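import Literature.NumberTheory.EllipticCurves.CongruentNewformThetaProofs
import Literature.NumberTheory.EllipticCurves.TunnellWeightTwoThetaProductsProofs
import Literature.NumberTheory.EllipticCurves.ModularSymbols
import HarnessLib

/-!
# `φ(z + 1/4) = i φ(z)` for the congruent-number newform `φ` and its modular symbols

[[cite: Tunnell1983Congruent, p. 325]] (`φ = ∑ a(n) qⁿ`, the newform of `y² = x³ - x` of level
`32`; its `q`-expansion is supported on `n ≡ 1 (mod 4)`: the double series
`½ ∑ (-1)^{n+b} (2n+1) q^{(2n+1)² + 4b²}`, `hasSum_congruentPhi_pairs`) — we PROVE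
`congruentPhi_vadd_quarter` (`φ(z + 1/4) = i φ(z)`), package `φ` as a weight-`2` cusp form on
`Γ₀(128)` (`congruentPhiCuspForm`, via `cuspFormTwoOfMem`) and deduce
**`modularSymbol_congruentPhi_add_quarter`**: `{∞, r + 1/4}_φ = i {∞, r}_φ` — the symmetry
that makes all mod-`8` class sums of the symbols `{∞, x/(8D)}_φ` multiples of one of them in
the evaluation of the diagonal Shintani coefficient.

No named facts; the only definition is `congruentPhiCuspForm`.
-/

noncomputable section

open scoped MatrixGroups ModularForm
open UpperHalfPlane hiding I
open Complex Filter Topology CongruenceSubgroup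
open Literature.NumberTheory.EllipticCurves.ModularForms
open Literature.NumberTheory.EllipticCurves.Tunnell1983

namespace Literature.NumberTheory.EllipticCurves.Shintani

/-- `q(z + 1/4)^N = i · q(z)^N` for `N ≡ 1 (mod 4)`. [folklore] -/
theorem qParam_vadd_quarter_pow {N : ℕ} (hN : N % 4 = 1) (z : ℍ) :
    Function.Periodic.qParam 1 (((((1 / 4 : ℝ)) +ᵥ z) : ℍ) : ℂ) ^ N = I * Function.Periodic.qParam 1 (z : ℂ) ^ N := by
  rw [Function.Periodic.qParam, Function.Periodic.qParam, ← Complex.exp_nat_mul, ← Complex.exp_nat_mul,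
    UpperHalfPlane.coe_vadd]
  obtain ⟨k, hk⟩ : ∃ k, N = 4 * k + 1 := ⟨N / 4, by omega⟩
  rw [show (N : ℂ) * (2 * Real.pi * I * (((((1 / 4 : ℝ)) : ℂ) + (z : ℂ))) / (1 : ℝ)) =
      ((k : ℤ) : ℂ) * (2 * Real.pi * I) + Real.pi / 2 * I + (N : ℂ) * (2 * Real.pi * I * (z : ℂ) / (1 : ℝ)) by
    rw [hk]; push_cast; ring, Complex.exp_add, Complex.exp_add, Complex.exp_int_mul_two_pi_mul_I, one_mul,
    Complex.exp_pi_div_two_mul_I]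

/-- **`φ(z + 1/4) = i φ(z)`**: the exponents `(2n+1)² + 4b²` of the double series of `φ` are
`≡ 1 (mod 4)`. [cite: Tunnell1983Congruent, p. 325] -/
theorem congruentPhi_vadd_quarter (z : ℍ) : congruentPhi (((1 / 4 : ℝ)) +ᵥ z) = I * congruentPhi z := by
  have h1 := hasSum_congruentPhi_pairs (((1 / 4 : ℝ)) +ᵥ z)
  have h2 := (hasSum_congruentPhi_pairs z).mul_left I
  refine h1.unique (h2.congr_fun fun x ↦ ?_)
  have hmod : ((2 * x.1 + 1) ^ 2 + 4 * x.2 ^ 2).toNat % 4 = 1 := by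
    have hnn : 0 ≤ (2 * x.1 + 1) ^ 2 + 4 * x.2 ^ 2 := by positivity
    have h4 : ((2 * x.1 + 1) ^ 2 + 4 * x.2 ^ 2) % 4 = 1 := by
      have : (2 * x.1 + 1) ^ 2 + 4 * x.2 ^ 2 = 4 * (x.1 ^ 2 + x.1 + x.2 ^ 2) + 1 := by ring
      rw [this]; omega
    have := Int.toNat_of_nonneg hnn
    omega
  rw [qParam_vadd_quarter_pow hmod]
  ring

/-- `φ` as a cusp form of weight `2` on `Γ₀(128)`. [folklore] -/
def congruentPhiCuspForm : CuspForm (Gamma0 128) 2 :=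
  cuspFormTwoOfMem (N := 128) (by norm_num) congruentPhi congruentPhi_mem

/-- The coercion of `congruentPhiCuspForm`. [folklore] -/
@[simp] theorem congruentPhiCuspForm_apply (z : ℍ) : congruentPhiCuspForm z = congruentPhi z :=
  cuspFormTwoOfMem_apply (N := 128) _ _ _ z

/-- **`{∞, r + 1/4}_φ = i · {∞, r}_φ`.** [folklore] -/
theorem modularSymbol_congruentPhi_add_quarter (r : ℚ) :
    modularSymbol congruentPhiCuspForm (r + 1 / 4) = I * modularSymbol congruentPhiCuspForm r := by
  rw [modularSymbol, modularSymbol]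
  have key : ∫ t in Set.Ioi (0 : ℝ), (congruentPhiCuspForm : ℍ → ℂ) (UpperHalfPlane.ofComplex ((((r + 1 / 4 : ℚ) : ℂ)) + t * I)) =
      ∫ t in Set.Ioi (0 : ℝ), I * (congruentPhiCuspForm : ℍ → ℂ) (UpperHalfPlane.ofComplex (((r : ℂ)) + t * I)) := by
    refine MeasureTheory.setIntegral_congr_fun (measurableSet_Ioi : MeasurableSet (Set.Ioi (0 : ℝ))) fun t ht ↦ ?_
    have ht : 0 < t := ht
    have him : 0 < (((r : ℂ)) + t * I).im := by simpa using ht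
    have him' : 0 < ((((r + 1 / 4 : ℚ) : ℂ)) + t * I).im := by simpa using ht
    have hpt : UpperHalfPlane.ofComplex ((((r + 1 / 4 : ℚ) : ℂ)) + t * I) =
        ((1 / 4 : ℝ)) +ᵥ UpperHalfPlane.ofComplex (((r : ℂ)) + t * I) := by
      apply UpperHalfPlane.ext
      rw [UpperHalfPlane.ofComplex_apply_of_im_pos him', UpperHalfPlane.coe_vadd,
        UpperHalfPlane.ofComplex_apply_of_im_pos him]
      push_cast; ring
    rw [congruentPhiCuspForm_apply, congruentPhiCuspForm_apply, hpt, congruentPhi_vadd_quarter]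
  rw [key, MeasureTheory.integral_const_mul]
  ring

end Literature.NumberTheory.EllipticCurves.Shintani
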